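import Literature.NumberTheory.EllipticCurves.PeriodRationalityProofs
import Literature.NumberTheory.EllipticCurves.CuspRayIntegrals
import HarnessLib

/-!
# Rationality of the periods of a newform at the cusps of a fixed class, and the cusp ray moments

Topic `Literature/NumberTheory/EllipticCurves`, namespace
`Literature.NumberTheory.EllipticCurves.ModularForms` (continuing `PeriodRationalityProofs` and
`CuspRayIntegrals`).

For a newform `f ∈ S_{n+2}(Γ₀(N))` of even weight `n + 2 ≥ 4` with coefficient field `K_f`, write
`R_f = K_f · {φ(f) : φ ∈ C}` for the `K_f`-span of its cuspidal period values (a `K_f`-plane,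
`IsNewform0.exists_submodule_coeffField_cuspidalLatticeK`; `= K_f Ω⁺ ⊕ K_f Ω⁻ i`,
`IsNewform0.exists_re_im_mem_span_cuspidalLatticeK`).  This file proves:

* `exists_cycle_of_cuspOrbitOf_eq` — **chain bookkeeping** (no newform needed): for `g, h ∈ SL₂(ℤ)`
  with `Γ₀(N) g∞ = Γ₀(N) h∞` and `q ∈ ℤ²`, the functional `λ_{g,q} : f ↦ c_f(g)(q)` differs from an
  INTEGER combination of `λ_{h,(0,1)}` and `λ_{S,(1,0)}` by `Ψ` of an integral boundary-free chain
  (Manin's trick `exists_chainK` gives `λ_{g,q} = Ψ(c)` with `δ(c) = q₁ⁿ[g∞] − (gq)₁ⁿ[∞]`, and the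
  boundary map only sees cusp CLASSES).
* `IsNewform0.periodFn_mem_span_of_cuspOrbitOf_eq` — hence **`c_f(g)(q) ∈ R_f` for every `g` whose
  cusp `g∞` lies in the class of `h∞`, as soon as `c_f(h)(0,1) ∈ R_f`**; in particular for the classes
  of `∞` (`c_f(1) = 0`) and of `0 = S∞` (`IsNewform0.periodFn_S_mem_span`, the Hecke-at-`S` trick of
  `PeriodRationalityProofs`): `…_of_cuspOrbitOf_eq_one`, `…_of_cuspOrbitOf_eq_S`.  For `p ∤ N` every
  cusp `a/pᵐ` is in the class of `0` (`cuspOrbitOf_eq_S_of_isCoprime`: `gcd(c, N) = 1 ⇒ [a/c] = [0]`).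
* `tendsto_eichlerKernel_cusp0`, `periodFn_eq_neg_sum_rayMoment` — **the period is the integral from
  the cusp**, for `Γ₀(N)` and with honest integrals: `c_f(γ)(q) = −∑ⱼ C(n,j) M_j(γ∞) v'ʲ(−u')ⁿ⁻ʲ`,
  `(u', v') = γq`, where `M_j(x) = rayMoment f j x = ∫ₓ^{i∞} f(z) zʲ dz` (`CuspRayIntegrals`).
* `IsNewform0.exists_fg_rayMoment_mem` — **bounded denominators**: there is a finitely generated
  subgroup `M ⊆ R_f` containing every cusp ray moment `M_j(γ∞)`, `0 ≤ j ≤ n`, for all `γ` with `γ∞` in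
  the class of `h∞` (integrality of the Manin chains, Noetherianity of `ℤ^{cosets × (n+1)}`, and the
  Vandermonde inversion expressing the moments through the periods at the `n + 1` integer points
  `γ⁻¹(−i, 1)`); corollaries `…_of_isCoprime` (all cusps `a/c`, `gcd(c, N) = 1`).

These are the algebraicity-with-bounded-denominators inputs for the Mazur–Tate–Teitelbaum measure of
an ordinary `p`-stabilised newform in weight `k = n + 2` (Mazur–Tate–Teitelbaum 1986, §I.14;
Bellaïche, *The Eigenbook*, Thm. 6.7.9), in the tree's vocabulary (`mttDistribution`,
`MazurTateTeitelbaumDistribution`).  Everything is proved; there are no named facts.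

## References

* Ju. I. Manin, *Periods of parabolic forms and p-adic Hecke series*, Mat. Sb. 92 (1973), §1,
  Thm. 1.2–1.3 (periods between cusps, rationality over `K_f`).
* G. Shimura, *On the periods of modular forms*, Math. Ann. 229 (1977), Thm. 1.
* B. Mazur, J. Tate, J. Teitelbaum, *On p-adic analogues of the conjectures of Birch and
  Swinnerton-Dyer*, Invent. Math. 84 (1986), §I.10–I.14.
-/

noncomputable section

open scoped MatrixGroups ModularForm Topology
open CongruenceSubgroup Complex MeasureTheory Set Filter Matrix.SpecialLinearGroup ModularGroup
open UpperHalfPlane hiding I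

namespace Literature.NumberTheory.EllipticCurves.ModularForms

/-! ### Cusp classes: `gcd(c, N) = 1 ⇒ Γ₀(N)(a/c) = Γ₀(N) 0` -/

section Classes

variable (N : ℕ) [NeZero N]

/-- **Cusps with denominator prime to the level are equivalent to `0`**: for `g = (a *; c *) ∈ SL₂(ℤ)`
with `gcd(c, N) = 1`, `Γ₀(N) g∞ = Γ₀(N) S∞` (`S∞ = 0`): with `uc + vaN = 1` the matrix
`γ = (u a; −vN c) ∈ Γ₀(N)` has `γS = (a −u; c vN)`, same first column as `g`
(Diamond–Shurman §3.8, Prop. 3.8.3). [folklore] -/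
theorem cuspOrbitOf_eq_S_of_isCoprime {g : SL(2, ℤ)} (hg : IsCoprime (g 1 0) (N : ℤ)) :
    cuspOrbitOf N g = cuspOrbitOf N ModularGroup.S := by
  have hdet : g 0 0 * g 1 1 - g 0 1 * g 1 0 = 1 := by
    have h := Matrix.det_fin_two (g : Matrix (Fin 2) (Fin 2) ℤ)
    rw [g.det_coe] at h
    exact h.symm
  have hca : IsCoprime (g 1 0) (g 0 0) := ⟨-g 0 1, g 1 1, by linear_combination hdet⟩
  obtain ⟨u, v, huv⟩ := hca.mul_right hg
  let γ : SL(2, ℤ) := ⟨!![u, g 0 0; -(v * N), g 1 0], by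
    rw [Matrix.det_fin_two_of]; linear_combination huv⟩
  have hγ : γ ∈ Gamma0 N := by
    rw [Gamma0_mem]
    change (((-(v * N) : ℤ)) : ZMod N) = 0
    push_cast
    simp
  rw [← cuspOrbitOf_mul_of_mem hγ ModularGroup.S]
  refine (cuspOrbitOf_eq_of_apply_eq 1 (Or.inl rfl) ?_ ?_).symm
  · simp [γ, Matrix.mul_apply, Fin.sum_univ_two, ModularGroup.coe_S]
  · simp [γ, Matrix.mul_apply, Fin.sum_univ_two, ModularGroup.coe_S]

/-- The same for the Manin matrix `δ_r` of a rational cusp `r` with denominator prime to `N`: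
`Γ₀(N) r = Γ₀(N) 0`. [folklore] -/
theorem cuspOrbitOf_cuspMatrix_eq_S_of_isCoprime {r : ℚ} (hr : IsCoprime (r.den : ℤ) (N : ℤ)) :
    cuspOrbitOf N (cuspMatrix r) = cuspOrbitOf N ModularGroup.S :=
  cuspOrbitOf_eq_S_of_isCoprime N (by rwa [cuspMatrix_apply_one_zero])

end Classes

/-! ### Chain bookkeeping: periods at cusps of a fixed class -/

section Chains

open Module LinearMap
open scoped Classical

variable {N : ℕ} [NeZero N] {n : ℕ}

/-- **Periods at cusps of the same class differ by cuspidal classes**: for `g, h ∈ SL₂(ℤ)` with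
`Γ₀(N) g∞ = Γ₀(N) h∞` and `q ∈ ℤ²` there is an integral chain `c ∈ 𝕄` with `δ(c) = 0` and
`Ψ(c) = λ_{g,q} − q₁ⁿ λ_{h,(0,1)} + (q₁ⁿ h₁₁ⁿ − (gq)₁ⁿ) λ_{S,(1,0)}` — the Manin chains of the three
functionals (`exists_chainK`) have boundaries `q₁ⁿ[g∞] − (gq)₁ⁿ[∞]`, `[h∞] − h₁₁ⁿ[∞]` and `−[∞]`.
[cite: Manin1972, Thm. 1.6] -/
theorem exists_cycle_of_cuspOrbitOf_eq (hn : Even n) (hn0 : n ≠ 0) {g h : SL(2, ℤ)}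
    (hgh : cuspOrbitOf N g = cuspOrbitOf N h) (q : Fin 2 → ℤ) :
    ∃ c : Gamma0Coset N → Fin (n + 1) → ℚ, (∀ x j, ∃ m : ℤ, c x j = m) ∧ bdryKMap N n c = 0 ∧
      msymbKMap N n c = periodFnDual n g q - (((q 1 : ℤ) : ℚ) ^ n) • periodFnDual n h ![0, 1] +
        (((q 1 : ℤ) : ℚ) ^ n * ((h 1 1 : ℤ) : ℚ) ^ n -
          ((((g : Matrix (Fin 2) (Fin 2) ℤ).mulVec q) 1 : ℤ) : ℚ) ^ n) •
            periodFnDual n ModularGroup.S ![1, 0] := by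
  obtain ⟨cg, hig, hΨg, hδg⟩ := exists_chainK (N := N) n hn g q
  obtain ⟨ch, hih, hΨh, hδh⟩ := exists_chainK (N := N) n hn h ![0, 1]
  obtain ⟨cS, hiS, hΨS, hδS⟩ := exists_chainK (N := N) n hn ModularGroup.S ![1, 0]
  set b : ℤ := ((g : Matrix (Fin 2) (Fin 2) ℤ).mulVec q) 1 with hb
  refine ⟨cg - (((q 1 : ℤ) : ℚ) ^ n) • ch +
    (((q 1 : ℤ) : ℚ) ^ n * ((h 1 1 : ℤ) : ℚ) ^ n - ((b : ℤ) : ℚ) ^ n) • cS, ?_, ?_, ?_⟩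
  · intro x j
    obtain ⟨m₁, h₁⟩ := hig x j
    obtain ⟨m₂, h₂⟩ := hih x j
    obtain ⟨m₃, h₃⟩ := hiS x j
    refine ⟨m₁ - q 1 ^ n * m₂ + (q 1 ^ n * h 1 1 ^ n - b ^ n) * m₃, ?_⟩
    simp only [Pi.add_apply, Pi.sub_apply, Pi.smul_apply, smul_eq_mul, h₁, h₂, h₃]
    push_cast
    ring
  · have hh1 : ((((h : Matrix (Fin 2) (Fin 2) ℤ).mulVec ![0, 1]) 1 : ℤ) : ℚ) = ((h 1 1 : ℤ) : ℚ) := by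
      simp [Matrix.mulVec, dotProduct, Fin.sum_univ_two]
    have hS1 : ((((ModularGroup.S : Matrix (Fin 2) (Fin 2) ℤ).mulVec ![1, 0]) 1 : ℤ) : ℚ) = 1 := by
      simp [Matrix.mulVec, dotProduct, Fin.sum_univ_two, ModularGroup.coe_S]
    rw [map_add, map_sub, map_smul, map_smul, hδg, hδh, hδS, hgh, hh1, hS1]
    simp only [Matrix.cons_val_one, Int.cast_one, one_pow, one_smul, Matrix.cons_val_zero,
      Int.cast_zero, zero_pow hn0, zero_smul, zero_sub]
    module
  · rw [map_add, map_sub, map_smul, map_smul, hΨg, hΨh, hΨS]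

omit [NeZero N] in
/-- `(0, 1) ∈ ℤ²` complexified. [folklore] -/
theorem intVec_zero_one : (fun i ↦ (((![0, 1] : Fin 2 → ℤ) i : ℤ) : ℂ)) = ![(0 : ℂ), 1] := by
  funext i; fin_cases i <;> simp

omit [NeZero N] in
/-- `(1, 0) ∈ ℤ²` complexified. [folklore] -/
theorem intVec_one_zero : (fun i ↦ (((![1, 0] : Fin 2 → ℤ) i : ℤ) : ℂ)) = ![(1 : ℂ), 0] := by
  funext i; fin_cases i <;> simp

/-- Rational multiples stay in a `K`-subspace of `ℂ` (`ℚ ⊆ K`). [folklore] -/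
theorem ratCast_mul_mem_of_mem (K : IntermediateField ℚ ℂ) {R : Submodule K ℂ} (r : ℚ) {z : ℂ}
    (hz : z ∈ R) : (r : ℂ) * z ∈ R := by
  rw [← Rat.smul_def, ← algebraMap_smul K r z]
  exact R.smul_mem _ hz

/-- **Periods at all cusps of a class lie in the `K_f`-plane of the newform** (even weight
`n + 2 ≥ 4`): if `Γ₀(N) g∞ = Γ₀(N) h∞` and `c_f(h)(0, 1) ∈ R_f := K_f·{φ(f) : φ ∈ C}`, then
`c_f(g)(q) ∈ R_f` for every `q ∈ ℤ²` — by `exists_cycle_of_cuspOrbitOf_eq`, `ℚC = Ψ(ker δ)`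
(`span_cuspidalLatticeK_eq_map_ker`) and `c_f(S)(1, 0) ∈ R_f` (`IsNewform0.periodFn_S_mem_span`)
(Manin 1973, Thm. 1.3; Shimura 1977, Thm. 1). [cite: Shimura1977, Thm. 1] -/
theorem IsNewform0.periodFn_mem_span_of_cuspOrbitOf_eq (hn : Even n) (hn0 : n ≠ 0)
    {f : CuspForm (Gamma0 N) (n + 2)} (hf : IsNewform0 f) {g h : SL(2, ℤ)}
    (hgh : cuspOrbitOf N g = cuspOrbitOf N h)
    (hh : periodFn n f h ![0, 1] ∈ Submodule.span (coeffField f)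
      ((fun φ : Module.Dual ℂ (CuspForm (Gamma0 N) (n + 2)) ↦ φ f) '' (cuspidalLatticeK (N := N) n)))
    (q : Fin 2 → ℤ) :
    periodFn n f g (fun i ↦ (q i : ℂ)) ∈ Submodule.span (coeffField f)
      ((fun φ : Module.Dual ℂ (CuspForm (Gamma0 N) (n + 2)) ↦ φ f) '' (cuspidalLatticeK (N := N) n)) := by
  set K : IntermediateField ℚ ℂ := coeffField f with hKdef
  set R₀ := Submodule.span K
    ((fun φ : Module.Dual ℂ (CuspForm (Gamma0 N) (n + 2)) ↦ φ f) '' (cuspidalLatticeK (N := N) n))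
    with hR₀
  obtain ⟨c, -, hδ, hΨ⟩ := exists_cycle_of_cuspOrbitOf_eq (N := N) hn hn0 hgh q
  have hmem : msymbKMap N n c ∈ (LinearMap.ker (bdryKMap N n)).map (msymbKMap N n) :=
    Submodule.mem_map_of_mem (LinearMap.mem_ker.mpr hδ)
  rw [← span_cuspidalLatticeK_eq_map_ker hn hn0] at hmem
  have hv := apply_mem_span_of_mem_span_cuspidalLatticeK hmem K f
  rw [hΨ, LinearMap.add_apply, LinearMap.sub_apply, LinearMap.smul_apply, LinearMap.smul_apply,
    periodFnDual_apply, periodFnDual_apply, periodFnDual_apply, intVec_zero_one, intVec_one_zero,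
    Rat.smul_def, Rat.smul_def] at hv
  have hS : periodFn n f ModularGroup.S ![(1 : ℂ), 0] ∈ R₀ := by
    have := hf.periodFn_S_mem_span hn hn0 ![1, 0]
    rwa [intVec_one_zero] at this
  have key := R₀.sub_mem (R₀.add_mem hv (ratCast_mul_mem_of_mem K (((q 1 : ℤ) : ℚ) ^ n) hh))
    (ratCast_mul_mem_of_mem K (((q 1 : ℤ) : ℚ) ^ n * ((h 1 1 : ℤ) : ℚ) ^ n -
      ((((g : Matrix (Fin 2) (Fin 2) ℤ).mulVec q) 1 : ℤ) : ℚ) ^ n) hS)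
  convert key using 1
  ring

/-- **Cusps in the class of `∞`**: `c_f(g)(q) ∈ R_f` whenever `Γ₀(N) g∞ = Γ₀(N)∞` (`c_f(1) = 0`). [cite: Shimura1977, Thm. 1] -/
theorem IsNewform0.periodFn_mem_span_of_cuspOrbitOf_eq_one (hn : Even n) (hn0 : n ≠ 0)
    {f : CuspForm (Gamma0 N) (n + 2)} (hf : IsNewform0 f) {g : SL(2, ℤ)}
    (hg : cuspOrbitOf N g = cuspOrbitOf N 1) (q : Fin 2 → ℤ) :
    periodFn n f g (fun i ↦ (q i : ℂ)) ∈ Submodule.span (coeffField f)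
      ((fun φ : Module.Dual ℂ (CuspForm (Gamma0 N) (n + 2)) ↦ φ f) '' (cuspidalLatticeK (N := N) n)) :=
  hf.periodFn_mem_span_of_cuspOrbitOf_eq hn hn0 hg
    (by rw [periodFn_one]; exact Submodule.zero_mem _) q

/-- **Cusps in the class of `0`**: `c_f(g)(q) ∈ R_f` whenever `Γ₀(N) g∞ = Γ₀(N) 0` — e.g. every cusp
`a/c` with `gcd(c, N) = 1` (`cuspOrbitOf_eq_S_of_isCoprime`). [cite: Shimura1977, Thm. 1] -/
theorem IsNewform0.periodFn_mem_span_of_cuspOrbitOf_eq_S (hn : Even n) (hn0 : n ≠ 0)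
    {f : CuspForm (Gamma0 N) (n + 2)} (hf : IsNewform0 f) {g : SL(2, ℤ)}
    (hg : cuspOrbitOf N g = cuspOrbitOf N ModularGroup.S) (q : Fin 2 → ℤ) :
    periodFn n f g (fun i ↦ (q i : ℂ)) ∈ Submodule.span (coeffField f)
      ((fun φ : Module.Dual ℂ (CuspForm (Gamma0 N) (n + 2)) ↦ φ f) '' (cuspidalLatticeK (N := N) n)) :=
  hf.periodFn_mem_span_of_cuspOrbitOf_eq hn hn0 hg
    (by have := hf.periodFn_S_mem_span hn hn0 ![0, 1]; rwa [intVec_zero_one] at this) q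

end Chains

/-! ### The period is the integral from the cusp (level `Γ₀(N)`, honest integrals) -/

section CuspLimit

variable {N : ℕ} [NeZero N] {n : ℕ}

variable (n) in
/-- **The period is the integral from the cusp** (`Γ₀(N)` version of `tendsto_eichlerKernel_cusp`):
for `γ = (a b; c d) ∈ SL₂(ℤ)` with `c ≠ 0` and `f ∈ S_{n+2}(Γ₀(N))` the kernel
`∫_{a/c+iε}^{i∞} f(z)(zv' − u')ⁿ dz`, `(u', v') = γq`, tends to `−c_f(γ)(q)` as `ε → 0⁺` (evaluate
`periodFn_eq` at `τ = −d/c + iT`, `T = 1/(c²ε)`, where `γτ = a/c + iε`). [folklore] -/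
theorem tendsto_eichlerKernel_cusp0 (f : CuspForm (Gamma0 N) (n + 2)) (γ : SL(2, ℤ))
    (hc : (γ 1 0 : ℤ) ≠ 0) (q : Fin 2 → ℂ) :
    Tendsto (fun ε : ℝ ↦ eichlerKernel n ⇑f (ofComplex (((cuspRe γ : ℝ) : ℂ) + ε * I))
      ((icmat γ).mulVec q)) (𝓝[>] 0) (𝓝 (-periodFn n f γ q)) := by
  set c : ℝ := ((γ 1 0 : ℤ) : ℝ) with hcdef
  have hc' : c ≠ 0 := by rw [hcdef]; exact_mod_cast hc
  set x₀ : ℝ := -((γ 1 1 : ℤ) : ℝ) / ((γ 1 0 : ℤ) : ℝ) with hx₀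
  have h1 : Tendsto (fun T : ℝ ↦ eichlerKernel n (⇑f ∣[(n + 2 : ℤ)] γ) (ofComplex ((x₀ : ℂ) + T * I)) q)
      atTop (𝓝 0) :=
    (isCuspFunction_slash f γ).tendsto_eichlerKernel_atTop x₀ q
  have h2 : Tendsto (fun T : ℝ ↦ eichlerKernel n ⇑f (γ • ofComplex ((x₀ : ℂ) + T * I))
      ((icmat γ).mulVec q)) atTop (𝓝 (-periodFn n f γ q)) := by
    have := h1.sub_const (periodFn n f γ q)
    rw [zero_sub] at this
    refine this.congr fun T ↦ ?_
    rw [periodFn_eq f γ q (ofComplex ((x₀ : ℂ) + T * I))]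
    ring
  have h3 : Tendsto (fun T : ℝ ↦ eichlerKernel n ⇑f
      (ofComplex (((cuspRe γ : ℝ) : ℂ) + ((1 / (c ^ 2 * T) : ℝ) : ℂ) * I)) ((icmat γ).mulVec q))
      atTop (𝓝 (-periodFn n f γ q)) := by
    refine h2.congr' ?_
    filter_upwards [eventually_gt_atTop (0 : ℝ)] with T hT
    rw [hx₀, sl_smul_ofComplex_vertical γ hc hT]
  have h4 := h3.comp (tendsto_one_div_sq_mul_nhdsGT hc')
  refine h4.congr' ?_
  filter_upwards [self_mem_nhdsWithin] with ε (hε : 0 < ε)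
  simp only [Function.comp_apply]
  congr 3
  have : 1 / (c ^ 2 * (1 / (c ^ 2 * ε))) = ε := by field_simp
  rw [this]

/-- **The iterated Eichler integrals converge to the cusp ray moments**: if `t ↦ f(x + it)(x + it)ʲ`
is integrable on `(0, ∞)` (e.g. `x ∈ ℚ`, `integrableOn_cuspRay_mul_pow_rat`), then
`∫_{x+iε}^{i∞} f(z) zʲ dz → ∫ₓ^{i∞} f(z) zʲ dz = rayMoment f j x` as `ε → 0⁺`. [folklore] -/
theorem tendsto_powPrimitive_rayMoment {k : ℤ} (f : CuspForm (Gamma0 N) k) {x : ℝ} (j : ℕ)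
    (hint : IntegrableOn (fun t : ℝ ↦ f (ofComplex ((x : ℂ) + t * I)) * ((x : ℂ) + t * I) ^ j) (Ioi 0)) :
    Tendsto (fun ε : ℝ ↦ powPrimitive j ⇑f (ofComplex ((x : ℂ) + ε * I))) (𝓝[>] 0)
      (𝓝 (rayMoment ⇑f j x)) := by
  rw [rayMoment_def]
  have h := (tendsto_integral_Ioi_of_integrableOn hint).const_mul I
  refine h.congr' ?_
  filter_upwards [self_mem_nhdsWithin] with ε (hε : 0 < ε)
  have him : 0 < ((x : ℂ) + ε * I).im := by simpa using hε
  rw [(isCuspFunction_one f).powPrimitive_eq_integral j, coe_ofComplex him,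
    integral_Ioi_eq_integral_Ioi_add _ ε]
  congr 1
  refine setIntegral_congr_fun measurableSet_Ioi fun t _ ↦ ?_
  have e : (x : ℂ) + ε * I + t * I = (x : ℂ) + ((t + ε : ℝ) : ℂ) * I := by push_cast; ring
  simp only [e]

omit [NeZero N] in
/-- The cusp of `γ` as a complex number: `a/c`. [folklore] -/
theorem ofReal_cuspRe (γ : SL(2, ℤ)) :
    ((cuspRe γ : ℝ) : ℂ) = ((γ 0 0 : ℤ) : ℂ) / ((γ 1 0 : ℤ) : ℂ) := by
  rw [cuspRe]; push_cast; rfl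

/-- **The period in terms of the cusp ray moments**: for `γ = (a b; c d) ∈ SL₂(ℤ)` with `c ≠ 0`,
`c_f(γ)(q) = −∑ⱼ C(n,j) (∫_{a/c}^{i∞} f(z) zʲ dz) v'ʲ (−u')ⁿ⁻ʲ`, `(u', v') = γq` — i.e.
`c_f(γ)(q) = −∫_{γ∞}^{i∞} f(z)(zv' − u')ⁿ dz` with an absolutely convergent integral along the
vertical ray from the cusp (Manin 1973, §1). [cite: Manin1973, §1] -/
theorem periodFn_eq_neg_sum_rayMoment (f : CuspForm (Gamma0 N) (n + 2)) (γ : SL(2, ℤ))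
    (hc : (γ 1 0 : ℤ) ≠ 0) (q : Fin 2 → ℂ) :
    periodFn n f γ q = -∑ j ∈ Finset.range (n + 1), (n.choose j : ℂ) * rayMoment ⇑f j (cuspRe γ) *
      ((icmat γ).mulVec q 1) ^ j * (-((icmat γ).mulVec q 0)) ^ (n - j) := by
  have h1 := tendsto_eichlerKernel_cusp0 n f γ hc q
  have hint : ∀ j : ℕ, IntegrableOn (fun t : ℝ ↦ f (ofComplex (((cuspRe γ : ℝ) : ℂ) + t * I)) *
      (((cuspRe γ : ℝ) : ℂ) + t * I) ^ j) (Ioi 0) := fun j ↦ by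
    rw [ofReal_cuspRe]
    exact integrableOn_cuspRay_mul_pow f γ hc j
  have h2 : Tendsto (fun ε : ℝ ↦ eichlerKernel n ⇑f (ofComplex (((cuspRe γ : ℝ) : ℂ) + ε * I))
      ((icmat γ).mulVec q)) (𝓝[>] 0) (𝓝 (∑ j ∈ Finset.range (n + 1), (n.choose j : ℂ) *
        rayMoment ⇑f j (cuspRe γ) * ((icmat γ).mulVec q 1) ^ j * (-((icmat γ).mulVec q 0)) ^ (n - j))) := by
    simp only [eichlerKernel]
    refine tendsto_finsetSum _ fun j _ ↦ ?_
    exact (((tendsto_powPrimitive_rayMoment f j (hint j)).const_mul _).mul_const _).mul_const _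
  rw [← tendsto_nhds_unique h1 h2, neg_neg]

/-- The same at an integer point pulled back through `γ`: with `p = γ⁻¹q'` (`q' ∈ ℤ²`),
`c_f(γ)(p) = −∑ⱼ C(n,j) M_j(γ∞) q'₁ʲ (−q'₀)ⁿ⁻ʲ`. [folklore] -/
theorem periodFn_inv_mulVec_eq_neg_sum_rayMoment (f : CuspForm (Gamma0 N) (n + 2)) (γ : SL(2, ℤ))
    (hc : (γ 1 0 : ℤ) ≠ 0) (q' : Fin 2 → ℤ) :
    periodFn n f γ (fun i ↦ ((((γ⁻¹ : SL(2, ℤ)) : Matrix (Fin 2) (Fin 2) ℤ).mulVec q' i : ℤ) : ℂ)) =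
      -∑ j ∈ Finset.range (n + 1), (n.choose j : ℂ) * rayMoment ⇑f j (cuspRe γ) *
        ((q' 1 : ℤ) : ℂ) ^ j * (-((q' 0 : ℤ) : ℂ)) ^ (n - j) := by
  have hq : (icmat γ).mulVec
      (fun i ↦ ((((γ⁻¹ : SL(2, ℤ)) : Matrix (Fin 2) (Fin 2) ℤ).mulVec q' i : ℤ) : ℂ)) =
      fun i ↦ ((q' i : ℤ) : ℂ) := by
    have e : (fun i ↦ ((((γ⁻¹ : SL(2, ℤ)) : Matrix (Fin 2) (Fin 2) ℤ).mulVec q' i : ℤ) : ℂ)) =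
        (icmat γ⁻¹).mulVec fun i ↦ ((q' i : ℤ) : ℂ) := by
      funext i
      simp [icmat, Matrix.mulVec, dotProduct, Fin.sum_univ_two]
    rw [e, Matrix.mulVec_mulVec, ← icmat_mul, mul_inv_cancel, icmat_one, Matrix.one_mulVec]
  rw [periodFn_eq_neg_sum_rayMoment f γ hc, hq]

end CuspLimit

/-! ### Bounded denominators: finitely generated modules of periods and of cusp ray moments -/

section BoundedDenominators

open Module LinearMap
open scoped Classical

variable {N : ℕ} [NeZero N] {n : ℕ}

/-- **The periods at the cusps of a class have bounded denominators**: there is a finitely generated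
subgroup `M ⊆ R_f` containing `c_f(g)(q)` for every `q ∈ ℤ²` and every `g` with `g∞` in the class of
`h∞` (given `c_f(h)(0,1) ∈ R_f`) — namely the `Ψ(c)(f)` of the INTEGRAL boundary-free chains `c` (a
subgroup of the finitely generated free group `ℤ^{cosets × (n+1)}`, hence finitely generated) together
with `c_f(h)(0,1)` and `c_f(S)(1,0)` (`exists_cycle_of_cuspOrbitOf_eq` has integer coefficients).
(Manin 1973, Thm. 1.3 with §1.) [cite: Shimura1977, Thm. 1] -/
theorem IsNewform0.exists_fg_periodFn_mem (hn : Even n) (hn0 : n ≠ 0)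
    {f : CuspForm (Gamma0 N) (n + 2)} (hf : IsNewform0 f) {h : SL(2, ℤ)}
    (hh : periodFn n f h ![0, 1] ∈ Submodule.span (coeffField f)
      ((fun φ : Module.Dual ℂ (CuspForm (Gamma0 N) (n + 2)) ↦ φ f) '' (cuspidalLatticeK (N := N) n))) :
    ∃ M : Submodule ℤ ℂ, M.FG ∧
      (∀ z ∈ M, z ∈ Submodule.span (coeffField f)
        ((fun φ : Module.Dual ℂ (CuspForm (Gamma0 N) (n + 2)) ↦ φ f) '' (cuspidalLatticeK (N := N) n))) ∧
      ∀ g : SL(2, ℤ), cuspOrbitOf N g = cuspOrbitOf N h → ∀ q : Fin 2 → ℤ,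
        periodFn n f g (fun i ↦ (q i : ℂ)) ∈ M := by
  set K : IntermediateField ℚ ℂ := coeffField f with hKdef
  set R₀ := Submodule.span K
    ((fun φ : Module.Dual ℂ (CuspForm (Gamma0 N) (n + 2)) ↦ φ f) '' (cuspidalLatticeK (N := N) n))
    with hR₀
  have hS : periodFn n f ModularGroup.S ![(1 : ℂ), 0] ∈ R₀ := by
    have := hf.periodFn_S_mem_span hn hn0 ![1, 0]
    rwa [intVec_one_zero] at this
  -- integral chains, integral cycles, and their realisation at `f`
  let ιZ : (Gamma0Coset N → Fin (n + 1) → ℤ) →ₗ[ℤ] (Gamma0Coset N → Fin (n + 1) → ℚ) :=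
    { toFun := fun z x j ↦ (z x j : ℚ)
      map_add' := fun z z' ↦ by funext x j; simp
      map_smul' := fun m z ↦ by funext x j; simp }
  let Z : Submodule ℤ (Gamma0Coset N → Fin (n + 1) → ℤ) :=
    LinearMap.ker (((bdryKMap N n).restrictScalars ℤ).comp ιZ)
  let Φ : (Gamma0Coset N → Fin (n + 1) → ℤ) →ₗ[ℤ] ℂ :=
    ((LinearMap.applyₗ (R := ℂ) f).restrictScalars ℤ).comp (((msymbKMap N n).restrictScalars ℤ).comp ιZ)
  have hΦ : ∀ z, Φ z = msymbKMap N n (ιZ z) f := fun z ↦ rfl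
  have hZfg : Z.FG := IsNoetherian.noetherian Z
  let M₂ : Submodule ℤ ℂ :=
    Submodule.span ℤ {periodFn n f h ![0, 1], periodFn n f ModularGroup.S ![1, 0]}
  refine ⟨Z.map Φ ⊔ M₂, (hZfg.map Φ).sup (Submodule.fg_span (Set.toFinite _)), ?_, ?_⟩
  · intro z hz
    obtain ⟨z₁, hz₁, z₂, hz₂, rfl⟩ := Submodule.mem_sup.mp hz
    refine R₀.add_mem ?_ ?_
    · obtain ⟨w, hw, rfl⟩ := Submodule.mem_map.mp hz₁
      have hw0 : bdryKMap N n (ιZ w) = 0 := LinearMap.mem_ker.mp hw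
      have hmem : msymbKMap N n (ιZ w) ∈ (LinearMap.ker (bdryKMap N n)).map (msymbKMap N n) :=
        Submodule.mem_map_of_mem (LinearMap.mem_ker.mpr hw0)
      rw [← span_cuspidalLatticeK_eq_map_ker hn hn0] at hmem
      rw [hΦ]
      exact apply_mem_span_of_mem_span_cuspidalLatticeK hmem K f
    · obtain ⟨a, b, rfl⟩ := Submodule.mem_span_pair.mp hz₂
      exact R₀.add_mem (zsmul_mem hh a) (zsmul_mem hS b)
  · intro g hg q
    obtain ⟨c, hint, hδ, hΨ⟩ := exists_cycle_of_cuspOrbitOf_eq (N := N) hn hn0 hg q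
    set b : ℤ := ((g : Matrix (Fin 2) (Fin 2) ℤ).mulVec q) 1 with hb
    choose m hm using hint
    have hc : ιZ m = c := by funext x j; exact (hm x j).symm
    have hmZ : m ∈ Z := by
      rw [LinearMap.mem_ker, LinearMap.comp_apply, hc]
      exact hδ
    have h1 : Φ m ∈ Z.map Φ := Submodule.mem_map_of_mem hmZ
    have ea : (((q 1 : ℤ) : ℚ) ^ n) = (((q 1 ^ n : ℤ)) : ℚ) := by push_cast; rfl
    have em : (((q 1 : ℤ) : ℚ) ^ n * ((h 1 1 : ℤ) : ℚ) ^ n - ((b : ℤ) : ℚ) ^ n) =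
        (((q 1 ^ n * h 1 1 ^ n - b ^ n : ℤ)) : ℚ) := by push_cast; rfl
    have key : periodFn n f g (fun i ↦ (q i : ℂ)) = Φ m + (q 1 ^ n : ℤ) • periodFn n f h ![0, 1] -
        (q 1 ^ n * h 1 1 ^ n - b ^ n : ℤ) • periodFn n f ModularGroup.S ![1, 0] := by
      rw [hΦ, hc, hΨ, LinearMap.add_apply, LinearMap.sub_apply, LinearMap.smul_apply,
        LinearMap.smul_apply, periodFnDual_apply, periodFnDual_apply, periodFnDual_apply,
        intVec_zero_one, intVec_one_zero, em, ea, Int.cast_smul_eq_zsmul, Int.cast_smul_eq_zsmul]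
      abel
    rw [key]
    refine Submodule.sub_mem _ (Submodule.add_mem _ (Submodule.mem_sup_left h1)
      (Submodule.mem_sup_right (Submodule.smul_mem _ _ (Submodule.subset_span (by simp)))))
      (Submodule.mem_sup_right (Submodule.smul_mem _ _ (Submodule.subset_span (by simp))))

omit [NeZero N] in
/-- **The evaluation matrix `(C(n,j) iⁿ⁻ʲ)_{i,j}` is invertible over `ℚ`** (a column-reversed
Vandermonde matrix at the nodes `0, …, n` times the diagonal of binomial coefficients). [folklore] -/
theorem isUnit_det_binomMomentMatrix :
    IsUnit (Matrix.of fun i j : Fin (n + 1) ↦ (n.choose (j : ℕ) : ℚ) * ((i : ℕ) : ℚ) ^ (n - (j : ℕ))).det := by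
  have hQeq : (Matrix.of fun i j : Fin (n + 1) ↦ (n.choose (j : ℕ) : ℚ) * ((i : ℕ) : ℚ) ^ (n - (j : ℕ))) =
      ((Matrix.vandermonde fun i : Fin (n + 1) ↦ ((i : ℕ) : ℚ)).submatrix id
        ⇑(Fin.revPerm : Equiv.Perm (Fin (n + 1)))) *
          Matrix.diagonal (fun j : Fin (n + 1) ↦ (n.choose (j : ℕ) : ℚ)) := by
    ext i j
    simp only [Matrix.mul_diagonal, Matrix.submatrix_apply, id_eq, Matrix.vandermonde_apply,
      Fin.revPerm_apply, Fin.val_rev, Matrix.of_apply]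
    rw [mul_comm]
    congr 2
    omega
  rw [hQeq, Matrix.det_mul, Matrix.det_permute', Matrix.det_diagonal, isUnit_iff_ne_zero]
  refine mul_ne_zero (mul_ne_zero ?_ (Matrix.det_vandermonde_ne_zero_iff.mpr ?_)) ?_
  · exact Int.cast_ne_zero.mpr (Units.ne_zero _)
  · intro i j hij
    have hij' : ((i : ℕ) : ℚ) = ((j : ℕ) : ℚ) := hij
    exact Fin.ext (by exact_mod_cast hij')
  · exact Finset.prod_ne_zero_iff.mpr fun j _ ↦ by
      exact_mod_cast (Nat.choose_pos (Nat.lt_succ_iff.mp j.2)).ne'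

/-- **The cusp ray moments at the cusps of a class have bounded denominators**: there is a finitely
generated subgroup `M ⊆ R_f = K_f·{φ(f) : φ ∈ C}` containing `∫_{γ∞}^{i∞} f(z) zʲ dz` for all
`0 ≤ j ≤ n` and all `γ = (a b; c d)`, `c ≠ 0`, with `γ∞` in the class of `h∞` (given
`c_f(h)(0,1) ∈ R_f`): the moments are a FIXED rational (inverse Vandermonde) combination of the
periods `−c_f(γ)(γ⁻¹(−i, 1))`, `i = 0, …, n` (`periodFn_inv_mulVec_eq_neg_sum_rayMoment`), which lie
in the finitely generated group of `IsNewform0.exists_fg_periodFn_mem`.  This is the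
"algebraic with bounded denominators" input of the Mazur–Tate–Teitelbaum measure
(Mazur–Tate–Teitelbaum 1986, §I.10; Manin 1973, Thm. 1.3). [cite: Shimura1977, Thm. 1] -/
theorem IsNewform0.exists_fg_rayMoment_mem (hn : Even n) (hn0 : n ≠ 0)
    {f : CuspForm (Gamma0 N) (n + 2)} (hf : IsNewform0 f) {h : SL(2, ℤ)}
    (hh : periodFn n f h ![0, 1] ∈ Submodule.span (coeffField f)
      ((fun φ : Module.Dual ℂ (CuspForm (Gamma0 N) (n + 2)) ↦ φ f) '' (cuspidalLatticeK (N := N) n))) :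
    ∃ M : Submodule ℤ ℂ, M.FG ∧
      (∀ z ∈ M, z ∈ Submodule.span (coeffField f)
        ((fun φ : Module.Dual ℂ (CuspForm (Gamma0 N) (n + 2)) ↦ φ f) '' (cuspidalLatticeK (N := N) n))) ∧
      ∀ γ : SL(2, ℤ), (γ 1 0 : ℤ) ≠ 0 → cuspOrbitOf N γ = cuspOrbitOf N h →
        ∀ j ≤ n, rayMoment ⇑f j (cuspRe γ) ∈ M := by
  set K : IntermediateField ℚ ℂ := coeffField f with hKdef
  set R₀ := Submodule.span K
    ((fun φ : Module.Dual ℂ (CuspForm (Gamma0 N) (n + 2)) ↦ φ f) '' (cuspidalLatticeK (N := N) n))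
    with hR₀
  obtain ⟨M, ⟨G, hG⟩, hMR, hMper⟩ := hf.exists_fg_periodFn_mem hn hn0 hh
  -- the evaluation matrix and its inverse
  set Q : Matrix (Fin (n + 1)) (Fin (n + 1)) ℚ :=
    Matrix.of fun i j : Fin (n + 1) ↦ (n.choose (j : ℕ) : ℚ) * ((i : ℕ) : ℚ) ^ (n - (j : ℕ)) with hQdef
  have hQ : IsUnit Q.det := isUnit_det_binomMomentMatrix
  let M' : Submodule ℤ ℂ := Submodule.span ℤ
    ((fun x : (Fin (n + 1) × Fin (n + 1)) × ℂ ↦ ((Q⁻¹ x.1.1 x.1.2 : ℚ) : ℂ) * x.2) '' (Set.univ ×ˢ (G : Set ℂ)))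
  refine ⟨M', Submodule.fg_span ((Set.finite_univ.prod G.finite_toSet).image _), ?_, ?_⟩
  · intro z hz
    refine Submodule.span_induction (p := fun z _ ↦ z ∈ R₀) ?_ (zero_mem _)
      (fun _ _ _ _ ha hb ↦ add_mem ha hb) (fun m _ _ ha ↦ zsmul_mem ha m) hz
    rintro _ ⟨⟨⟨j, i⟩, g⟩, ⟨-, hg⟩, rfl⟩
    exact ratCast_mul_mem_of_mem K _ (hMR g (hG ▸ Submodule.subset_span hg))
  · intro γ hc hγ j hj
    set R : Fin (n + 1) → ℂ := fun j ↦ rayMoment ⇑f j (cuspRe γ) with hRdef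
    set Kv : Fin (n + 1) → ℂ := fun i ↦ -periodFn n f γ (fun l ↦
      ((((γ⁻¹ : SL(2, ℤ)) : Matrix (Fin 2) (Fin 2) ℤ).mulVec ![-((i : ℕ) : ℤ), 1] l : ℤ) : ℂ)) with hKv
    have hKM : ∀ i, Kv i ∈ M := fun i ↦ M.neg_mem (hMper γ hγ _)
    have hrel : (Q.map (Rat.castHom ℂ)).mulVec R = Kv := by
      funext i
      rw [hKv]
      dsimp only
      rw [periodFn_inv_mulVec_eq_neg_sum_rayMoment f γ hc, neg_neg, Matrix.mulVec, dotProduct,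
        Finset.sum_range]
      refine Finset.sum_congr rfl fun j _ ↦ ?_
      simp only [hQdef, hRdef, Matrix.map_apply, Matrix.of_apply, Rat.coe_castHom, Rat.cast_mul,
        Rat.cast_natCast, Rat.cast_pow, Matrix.cons_val_one, Matrix.cons_val_zero, Int.cast_one,
        one_pow, mul_one, Int.cast_neg, Int.cast_natCast, neg_neg]
      ring
    have hR : R = (Q⁻¹.map (Rat.castHom ℂ)).mulVec Kv := by
      rw [← hrel, Matrix.mulVec_mulVec, ← Matrix.map_mul, Matrix.nonsing_inv_mul _ hQ,
        Matrix.map_one _ (map_zero _) (map_one _), Matrix.one_mulVec]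
    have hj' : j < n + 1 := Nat.lt_succ_of_le hj
    have e : rayMoment ⇑f j (cuspRe γ) = R ⟨j, hj'⟩ := rfl
    rw [e, hR, Matrix.mulVec, dotProduct]
    refine Submodule.sum_mem _ fun i _ ↦ ?_
    rw [Matrix.map_apply, Rat.coe_castHom]
    have hKi : Kv i ∈ Submodule.span ℤ (G : Set ℂ) := by rw [hG]; exact hKM i
    have hle : (Submodule.span ℤ (G : Set ℂ)).map (LinearMap.mulLeft ℤ ((Q⁻¹ ⟨j, hj'⟩ i : ℚ) : ℂ)) ≤ M' := by
      rw [Submodule.map_span_le]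
      intro g hg
      exact Submodule.subset_span ⟨⟨⟨⟨j, hj'⟩, i⟩, g⟩, ⟨Set.mem_univ _, hg⟩, rfl⟩
    exact hle (Submodule.mem_map_of_mem hKi)

/-- **All cusps with denominator prime to the level at once**: a finitely generated `M ⊆ R_f`
containing `∫_{a/c}^{i∞} f(z) zʲ dz` for all `0 ≤ j ≤ n` and all `γ = (a *; c *) ∈ SL₂(ℤ)` with
`c ≠ 0`, `gcd(c, N) = 1` (these cusps form the class of `0`, `cuspOrbitOf_eq_S_of_isCoprime`, and
`c_f(S)(0,1) ∈ R_f`, `IsNewform0.periodFn_S_mem_span`). [cite: Shimura1977, Thm. 1] -/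
theorem IsNewform0.exists_fg_rayMoment_mem_of_isCoprime (hn : Even n) (hn0 : n ≠ 0)
    {f : CuspForm (Gamma0 N) (n + 2)} (hf : IsNewform0 f) :
    ∃ M : Submodule ℤ ℂ, M.FG ∧
      (∀ z ∈ M, z ∈ Submodule.span (coeffField f)
        ((fun φ : Module.Dual ℂ (CuspForm (Gamma0 N) (n + 2)) ↦ φ f) '' (cuspidalLatticeK (N := N) n))) ∧
      ∀ γ : SL(2, ℤ), (γ 1 0 : ℤ) ≠ 0 → IsCoprime (γ 1 0) (N : ℤ) →
        ∀ j ≤ n, rayMoment ⇑f j (cuspRe γ) ∈ M := by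
  have hh : periodFn n f ModularGroup.S ![0, 1] ∈ Submodule.span (coeffField f)
      ((fun φ : Module.Dual ℂ (CuspForm (Gamma0 N) (n + 2)) ↦ φ f) '' (cuspidalLatticeK (N := N) n)) := by
    have := hf.periodFn_S_mem_span hn hn0 ![0, 1]
    rwa [intVec_zero_one] at this
  obtain ⟨M, hfg, hMR, hM⟩ := hf.exists_fg_rayMoment_mem hn hn0 hh
  exact ⟨M, hfg, hMR, fun γ hc hγ j hj ↦ hM γ hc (cuspOrbitOf_eq_S_of_isCoprime N hγ) j hj⟩

omit [NeZero N] in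
/-- The cusp of the Manin matrix `δ_r` is `r`. [folklore] -/
theorem cuspRe_cuspMatrix (r : ℚ) : cuspRe (cuspMatrix r) = (r : ℝ) := by
  rw [cuspRe, cuspMatrix_apply_zero_zero, cuspMatrix_apply_one_zero, Rat.cast_def]
  push_cast
  rfl

/-- **Rational cusps with denominator prime to the level**: a finitely generated `M ⊆ R_f` containing
`∫_r^{i∞} f(z) zʲ dz = rayMoment f j r` for every `0 ≤ j ≤ n` and every `r ∈ ℚ` with
`gcd(den r, N) = 1` — for a prime `p ∤ N`, every `r = a/pᵐ`. [cite: Shimura1977, Thm. 1] -/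
theorem IsNewform0.exists_fg_rayMoment_rat_mem (hn : Even n) (hn0 : n ≠ 0)
    {f : CuspForm (Gamma0 N) (n + 2)} (hf : IsNewform0 f) :
    ∃ M : Submodule ℤ ℂ, M.FG ∧
      (∀ z ∈ M, z ∈ Submodule.span (coeffField f)
        ((fun φ : Module.Dual ℂ (CuspForm (Gamma0 N) (n + 2)) ↦ φ f) '' (cuspidalLatticeK (N := N) n))) ∧
      ∀ r : ℚ, IsCoprime (r.den : ℤ) (N : ℤ) → ∀ j ≤ n, rayMoment ⇑f j (r : ℝ) ∈ M := by
  obtain ⟨M, hfg, hMR, hM⟩ := hf.exists_fg_rayMoment_mem_of_isCoprime hn hn0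
  refine ⟨M, hfg, hMR, fun r hr j hj ↦ ?_⟩
  have h := hM (cuspMatrix r) (by rw [cuspMatrix_apply_one_zero]; exact_mod_cast r.den_ne_zero)
    (by rwa [cuspMatrix_apply_one_zero]) j hj
  rwa [cuspRe_cuspMatrix] at h

end BoundedDenominators

end Literature.NumberTheory.EllipticCurves.ModularForms
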